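import Summits.SmoothPoincare4.SmoothPoincare4.Theses.InformationMetricHadamard
import Summits.SmoothPoincare4.SmoothPoincare4.Theorems.InformationMetricHadamardAhHadamardFillingReduction
import Summits.SmoothPoincare4.SmoothPoincare4.Theorems.AhHadamardFilling.Negative.OfSmoothPoincare4
import Summits.SmoothPoincare4.SmoothPoincare4.Theorems.AhHadamardFilling.Negative.TameFillingOfSmoothPoincare4

/-!
# Line `Sketch` of crux `AhHadamardFilling` is circular: its open stub X ↔ `SmoothPoincare4`

Negative side of crux `InformationMetricHadamard.AhHadamardFilling` (item stmt-SmoothPoincare4-6014,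
line `Sketch`, continuation lead c2). One-declaration certificates, pure logic over tree theorems:

* `tameFillingNoPi1_iff_smoothPoincare4` — the ONLY open registered stub of the line,
  X = `stub_tameFillingNoPi1` (skeleton `Cruxes/AhHadamardFilling/Lines/Sketch.lean`, r4), taken
  as a closed proposition `∀ S, X S`, is EQUIVALENT to the summit: `→` is
  `Sketch.smoothPoincare4_of_tameFillingNoPi1` (Reduction file: X feeds the landed K1
  `stub_locallyConvexEndForcesHadamard`, whose conclusion contains `S ≅ S⁴`), `←` is
  `tameFillingNoPi1_of_smoothPoincare4` (`W = ℍ⁵`, cone collar over `S ≅ S⁴ ⊂ ℝ⁵`). Hence no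
  worker, fact, computation or reshape inside the line can close it short of SPC4: the line is dead
  as a line (circular), while the crux itself is implied by SPC4
  (`ahHadamardFilling_of_smoothPoincare4`).
* `ahHadamardFilling_iff_smoothPoincare4_of_c0AhRecognition` — modulo the route's other crux
  `C0AhRecognition` (item 6015) the crux IS the summit (`→` = the route's deciding theorem
  `Theses.InformationMetricHadamard.closes`, `←` = `ahHadamardFilling_of_smoothPoincare4`).
-/

noncomputable section

open Set
open scoped Manifold ContDiff Topology NNReal

namespace Summit.SmoothPoincare4.SmoothPoincare4.Theorems.AhHadamardFilling.Negative

open Literature.Geometry.Lorentzian (PseudoRiemannianMetric)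
open Literature.Topology.FourManifolds (HomotopySphere)
open Summit.SmoothPoincare4.SmoothPoincare4.Theses.InformationMetricHadamard
  (AhHadamardFilling C0AhRecognition)

-- the prescribed namespace `Summit.<P>.<Sub>.…` duplicates `SmoothPoincare4` (P = Sub)
set_option linter.dupNamespace false

/-- **The open stub X of line `Sketch` is exactly the summit.** `(∀ S, X S) ↔ SmoothPoincare4`,
where `X S` is the registered signature of `stub_tameFillingNoPi1` verbatim (a Riemannian metric on
`S`, a complete connected Riemannian 5-manifold with `sec ≤ 0`, a proper smooth injective immersive
end collar with co-compact far parts, a `δ`-locally `d`-convex far complement of nonempty interior,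
and `C⁰` cone asymptotics). [folklore] -/
theorem tameFillingNoPi1_iff_smoothPoincare4 :
    (∀ S : HomotopySphere 4,
      ∃ (g : PseudoRiemannianMetric (𝓡 4) ∞ (EuclideanSpace ℝ (Fin 4)) (TangentSpace (𝓡 4) : S.carrier → Type _))
        (_ : g.IsRiemannian) (W : Type) (_ : TopologicalSpace W) (_ : T2Space W)
        (_ : SecondCountableTopology W) (_ : ChartedSpace (EuclideanSpace ℝ (Fin 5)) W)
        (_ : IsManifold (𝓡 5) ∞ W) (_ : ConnectedSpace W)
        (G : PseudoRiemannianMetric (𝓡 5) ∞ (EuclideanSpace ℝ (Fin 5)) (TangentSpace (𝓡 5) : W → Type _))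
        (hG : G.IsRiemannian) (c : ℝ) (Φ : S.carrier × ℝ → W),
        0 < c ∧
        (∀ (x : W) (r : NNReal), IsCompact {y : W | G.edist hG x y ≤ r}) ∧
        (∀ cov, G.IsLeviCivita cov →
          ∀ (x : W) (X Y : TangentSpace (𝓡 5) x), G.sectionalCurvature cov x X Y ≤ 0) ∧
        ContMDiffOn ((𝓡 4).prod 𝓘(ℝ, ℝ)) (𝓡 5) ∞ Φ (univ ×ˢ Ioo (0 : ℝ) 1) ∧
        InjOn Φ (univ ×ˢ Ioo (0 : ℝ) 1) ∧
        (∀ p ∈ univ ×ˢ Ioo (0 : ℝ) 1,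
          Function.Injective (mfderiv ((𝓡 4).prod 𝓘(ℝ, ℝ)) (𝓡 5) Φ p)) ∧
        (∀ t ∈ Ioo (0 : ℝ) 1, IsCompact (Φ '' (univ ×ˢ Ioo (0 : ℝ) t))ᶜ) ∧
        (∀ t ∈ Ioo (0 : ℝ) 1,
          closure (Φ '' (univ ×ˢ Ioo (0 : ℝ) t)) ⊆ Φ '' (univ ×ˢ Ioo (0 : ℝ) 1)) ∧
        (∃ t ∈ Ioo (0 : ℝ) 1, ∃ δ : ℝ, 0 < δ ∧
          (interior (Φ '' (univ ×ˢ Ioo (0 : ℝ) t))ᶜ).Nonempty ∧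
          ∀ p ∈ (Φ '' (univ ×ˢ Ioo (0 : ℝ) t))ᶜ, ∀ q ∈ (Φ '' (univ ×ˢ Ioo (0 : ℝ) t))ᶜ,
            G.edist hG p q < ENNReal.ofReal δ →
            ∀ m : W, G.edist hG p m + G.edist hG m q = G.edist hG p q →
              m ∈ (Φ '' (univ ×ˢ Ioo (0 : ℝ) t))ᶜ) ∧
        (∀ ε : ℝ, 0 < ε → ∃ t ∈ Ioo (0 : ℝ) 1, ∀ (x : S.carrier) (l : ℝ), l ∈ Ioo (0 : ℝ) t →
          ∀ (v : TangentSpace (𝓡 4) x) (s : ℝ),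
            |G.val (Φ (x, l)) (mfderiv ((𝓡 4).prod 𝓘(ℝ, ℝ)) (𝓡 5) Φ (x, l) (v, s))
                (mfderiv ((𝓡 4).prod 𝓘(ℝ, ℝ)) (𝓡 5) Φ (x, l) (v, s)) -
              c * (s ^ 2 + g.val x v v) / l ^ 2| ≤ ε * (c * (s ^ 2 + g.val x v v) / l ^ 2))) ↔
    _root_.SmoothPoincare4 :=
  ⟨fun hX ↦ Cruxes.AhHadamardFilling.Sketch.smoothPoincare4_of_tameFillingNoPi1 hX,
    fun hSPC4 S ↦ tameFillingNoPi1_of_smoothPoincare4 hSPC4 S⟩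

/-- **Modulo the route's recognition crux, the crux IS the summit.**
`C0AhRecognition → (AhHadamardFilling ↔ SmoothPoincare4)`: forward is the route's deciding theorem
`Theses.InformationMetricHadamard.closes`, backward is the hyperbolic witness
`ahHadamardFilling_of_smoothPoincare4`. [folklore] -/
theorem ahHadamardFilling_iff_smoothPoincare4_of_c0AhRecognition (hR : C0AhRecognition) :
    AhHadamardFilling ↔ _root_.SmoothPoincare4 :=
  ⟨fun hF ↦ Summit.SmoothPoincare4.SmoothPoincare4.Theses.InformationMetricHadamard.closes hR hF,
    ahHadamardFilling_of_smoothPoincare4⟩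

end Summit.SmoothPoincare4.SmoothPoincare4.Theorems.AhHadamardFilling.Negative

end
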